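import Summits.NavierStokesRegularity.NavierStokesRegularity.Theorems.EfficiencyFloorLerayFloorGapAttainment
import Literature.Analysis.FluidPDE.NSViscosityRescaling
import HarnessLib

/-!
# Route `EfficiencyFloor`, rung `LerayFloorGap`: the attainment dichotomy is VISCOSITY-FREE — normalised maximisers transfer
# between viscosities by amplitude scaling, so `c⋆` is attained at every `ν > 0` or at none

Helper file (`--supports stmt-NavierStokesRegularity-25482`), completing `…LerayFloorGapAttainment` (p824975). The normalisation
`Pal = (81c⋆⁴/(256ν⁴))·Z³` of the route decls depends on `ν`, but only through the amplitude: `m ↦ (ν'/ν)·m` multiplies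
`Z, Pal` by `(ν'/ν)²` and `S` by `(ν'/ν)³`, preserves admissibility and the efficiency identity `S = c⋆Z^{3/4}Pal^{3/4}`, and
moves the Young-optimal ratio from `ν` to `ν'`.

* `normalisedMaximiser_const_smul` — a normalised maximiser for `(c, ν)` rescaled by `ν'/ν` is one for `(c, ν')` (route clause
  verbatim; `curl_const_smul_eq`, `fderiv_curl_const_smul`, `IsDivFree.const_smul`, `frobeniusNormSq_const_smul` of the tree's
  `NSViscosityRescaling`).
* `attained_all_of_nearSaturationNearMaximiser` — `NearSaturationNearMaximiser` (25482) ⟹ a normalised maximiser exists at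
  EVERY `ν > 0` (upgrade of `attained_of_nearSaturationNearMaximiser`).
* `attainment_dichotomy` — for the sharp constant: EITHER normalised maximisers exist at every `ν > 0`, OR at no `ν > 0`
  (and then, by p824975, 25483/25512/25513 hold vacuously and 25482 fails).

HONEST FRAMING: elementary scaling bookkeeping; nothing decides attainment; 25482, 25483, 25512, 25513, `LerayFloorGap`,
`ProductionEfficiencyDecay` and Navier–Stokes regularity stay OPEN; no summit statement is proved. [folklore]
-/

-- the problem directory repeats the summit name (`NavierStokesRegularity/NavierStokesRegularity`)
set_option linter.dupNamespace false

noncomputable section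

namespace Summit.NavierStokesRegularity.NavierStokesRegularity.Theorems

namespace LerayFloorGap

namespace Attainment

open Set MeasureTheory Filter Topology Function
open scoped InnerProductSpace ENNReal
open Literature.Analysis.FluidPDE

/-- **Amplitude scaling moves a normalised maximiser from viscosity `ν` to `ν'`.** If `m` is a normalised maximiser for
`(c, ν)` (route clause verbatim) and `ν, ν' > 0`, then `(ν'/ν)·m` is a normalised maximiser for `(c, ν')`. [folklore] -/
theorem normalisedMaximiser_const_smul {c ν ν' : ℝ} (hν : 0 < ν) (hν' : 0 < ν')
    {m : EuclideanSpace ℝ (Fin 3) → EuclideanSpace ℝ (Fin 3)}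
    (hm : ((ContDiff ℝ (⊤ : ℕ∞) m ∧ Literature.Analysis.FluidPDE.VectorCalculus.IsDivFree m ∧ (∫⁻ x, ‖iteratedFDeriv ℝ
      0 m x‖ₑ ^ 2 < ⊤) ∧ (∫⁻ x, ‖iteratedFDeriv ℝ 1 m x‖ₑ ^ 2 < ⊤) ∧ (∫⁻ x, ‖iteratedFDeriv ℝ 2 m x‖ₑ ^ 2 < ⊤)) ∧
      0 < (∫ x, ‖Literature.Analysis.FluidPDE.curl m x‖ ^ 2) ∧ (∫ x, ⟪Literature.Analysis.FluidPDE.curl m x,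
      fderiv ℝ m x (Literature.Analysis.FluidPDE.curl m x)⟫_ℝ) = c * (∫ x, ‖Literature.Analysis.FluidPDE.curl m x‖
      ^ 2) ^ (3 / 4 : ℝ) * (∫ x, Literature.Analysis.FluidPDE.frobeniusNormSq (fderiv ℝ
      (Literature.Analysis.FluidPDE.curl m) x)) ^ (3 / 4 : ℝ) ∧ (∫ x, Literature.Analysis.FluidPDE.frobeniusNormSq
      (fderiv ℝ (Literature.Analysis.FluidPDE.curl m) x)) = 81 * c ^ 4 / (256 * ν ^ 4) * (∫ x,
      ‖Literature.Analysis.FluidPDE.curl m x‖ ^ 2) ^ 3)) :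
    ((ContDiff ℝ (⊤ : ℕ∞) (fun y => (ν' / ν) • m y) ∧ Literature.Analysis.FluidPDE.VectorCalculus.IsDivFree (fun
      y => (ν' / ν) • m y) ∧ (∫⁻ x, ‖iteratedFDeriv ℝ 0 (fun y => (ν' / ν) • m y) x‖ₑ ^ 2 < ⊤) ∧ (∫⁻ x,
      ‖iteratedFDeriv ℝ 1 (fun y => (ν' / ν) • m y) x‖ₑ ^ 2 < ⊤) ∧ (∫⁻ x, ‖iteratedFDeriv ℝ 2 (fun y => (ν' / ν) •
      m y) x‖ₑ ^ 2 < ⊤)) ∧ 0 < (∫ x, ‖Literature.Analysis.FluidPDE.curl (fun y => (ν' / ν) • m y) x‖ ^ 2) ∧ (∫ x,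
      ⟪Literature.Analysis.FluidPDE.curl (fun y => (ν' / ν) • m y) x, fderiv ℝ (fun y => (ν' / ν) • m y) x
      (Literature.Analysis.FluidPDE.curl (fun y => (ν' / ν) • m y) x)⟫_ℝ) = c * (∫ x,
      ‖Literature.Analysis.FluidPDE.curl (fun y => (ν' / ν) • m y) x‖ ^ 2) ^ (3 / 4 : ℝ) * (∫ x,
      Literature.Analysis.FluidPDE.frobeniusNormSq (fderiv ℝ (Literature.Analysis.FluidPDE.curl (fun y => (ν' / ν)
      • m y)) x)) ^ (3 / 4 : ℝ) ∧ (∫ x, Literature.Analysis.FluidPDE.frobeniusNormSq (fderiv ℝ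
      (Literature.Analysis.FluidPDE.curl (fun y => (ν' / ν) • m y)) x)) = 81 * c ^ 4 / (256 * ν' ^ 4) * (∫ x,
      ‖Literature.Analysis.FluidPDE.curl (fun y => (ν' / ν) • m y) x‖ ^ 2) ^ 3) := by
  obtain ⟨⟨hcd, hdiv, hL0, hL1, hL2⟩, hZ, hS, hP⟩ := hm
  set a : ℝ := ν' / ν with ha
  have ha0 : 0 < a := div_pos hν' hν
  have hdiff : Differentiable ℝ m := hcd.differentiable (by simp)
  have hcd2 : ContDiff ℝ 2 m := hcd.of_le (by norm_cast)
  have hcurl : curl (fun y => a • m y) = fun x => a • curl m x := curl_const_smul_eq hdiff a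
  have hfd : ∀ x, fderiv ℝ (fun y => a • m y) x = a • fderiv ℝ m x := fun x =>
    fderiv_fun_const_smul (hdiff x) a
  have hfdc : ∀ x, fderiv ℝ (curl fun y => a • m y) x = a • fderiv ℝ (curl m) x :=
    fderiv_curl_const_smul hcd2 a
  -- the three integrals scale by `a²`, `a³`, `a²`
  have hZ' : (∫ x, ‖curl (fun y => a • m y) x‖ ^ 2) = a ^ 2 * ∫ x, ‖curl m x‖ ^ 2 := by
    rw [hcurl, ← integral_const_mul]
    refine integral_congr_ae (Eventually.of_forall fun x => ?_)
    simp only [norm_smul, mul_pow, Real.norm_eq_abs, sq_abs]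
  have hP' : (∫ x, frobeniusNormSq (fderiv ℝ (curl fun y => a • m y) x)) =
      a ^ 2 * ∫ x, frobeniusNormSq (fderiv ℝ (curl m) x) := by
    rw [← integral_const_mul]
    refine integral_congr_ae (Eventually.of_forall fun x => ?_)
    simp only [hfdc x, frobeniusNormSq_const_smul]
  have hS' : (∫ x, ⟪curl (fun y => a • m y) x, fderiv ℝ (fun y => a • m y) x (curl (fun y => a • m y) x)⟫_ℝ) =
      a ^ 3 * ∫ x, ⟪curl m x, fderiv ℝ m x (curl m x)⟫_ℝ := by
    rw [hcurl, ← integral_const_mul]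
    refine integral_congr_ae (Eventually.of_forall fun x => ?_)
    simp only [hfd x, FunLike.coe_smul, Pi.smul_apply, map_smul, real_inner_smul_left, real_inner_smul_right]
    ring
  -- admissibility of the rescaled field
  have hcd' : ContDiff ℝ (⊤ : ℕ∞) (fun y => a • m y) := hcd.const_smul a
  have hdiv' : VectorCalculus.IsDivFree (fun y => a • m y) := VectorCalculus.IsDivFree.const_smul hdiff hdiv a
  have hLk : ∀ k : ℕ, (∫⁻ x, ‖iteratedFDeriv ℝ k m x‖ₑ ^ 2 < ⊤) →
      (∫⁻ x, ‖iteratedFDeriv ℝ k (fun y => a • m y) x‖ₑ ^ 2 < ⊤) := by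
    intro k hk
    have heq : ∀ x, iteratedFDeriv ℝ k (fun y => a • m y) x = a • iteratedFDeriv ℝ k m x := fun x =>
      iteratedFDeriv_const_smul_apply' ((hcd.of_le (by norm_cast; exact le_top)).contDiffAt)
    simp_rw [heq]
    rw [lintegral_enorm_sq_const_smul]
    exact ENNReal.mul_lt_top ENNReal.ofReal_lt_top hk
  have hZ0 : 0 ≤ ∫ x, ‖curl m x‖ ^ 2 := hZ.le
  have hP0 : 0 ≤ ∫ x, frobeniusNormSq (fderiv ℝ (curl m) x) := integral_nonneg fun _ => frobeniusNormSq_nonneg _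
  refine ⟨⟨hcd', hdiv', hLk 0 hL0, hLk 1 hL1, hLk 2 hL2⟩, ?_, ?_, ?_⟩
  · rw [hZ']; positivity
  · rw [hS', hZ', hP', hS, Real.mul_rpow (sq_nonneg a) hZ0, Real.mul_rpow (sq_nonneg a) hP0]
    have ha2 : (a ^ 2) ^ (3 / 4 : ℝ) * (a ^ 2) ^ (3 / 4 : ℝ) = a ^ 3 := by
      rw [← Real.rpow_add (pow_pos ha0 2), ← Real.rpow_natCast_mul ha0.le]
      norm_num
    calc a ^ 3 * ((c * (∫ x, ‖curl m x‖ ^ 2) ^ (3 / 4 : ℝ)) *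
          (∫ x, frobeniusNormSq (fderiv ℝ (curl m) x)) ^ (3 / 4 : ℝ))
        = ((a ^ 2) ^ (3 / 4 : ℝ) * (a ^ 2) ^ (3 / 4 : ℝ)) * ((c * (∫ x, ‖curl m x‖ ^ 2) ^ (3 / 4 : ℝ)) *
          (∫ x, frobeniusNormSq (fderiv ℝ (curl m) x)) ^ (3 / 4 : ℝ)) := by rw [ha2]
      _ = c * ((a ^ 2) ^ (3 / 4 : ℝ) * (∫ x, ‖curl m x‖ ^ 2) ^ (3 / 4 : ℝ)) *
          ((a ^ 2) ^ (3 / 4 : ℝ) * (∫ x, frobeniusNormSq (fderiv ℝ (curl m) x)) ^ (3 / 4 : ℝ)) := by ring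
  · rw [hP', hZ', hP, ha]
    field_simp

/-- **stmt-25482 ⟹ attainment at EVERY viscosity.** [folklore] -/
theorem attained_all_of_nearSaturationNearMaximiser
    (hN : Summit.NavierStokesRegularity.NavierStokesRegularity.Theses.EfficiencyFloor.NearSaturationNearMaximiser) :
    ∀ c : ℝ, (0 < c ∧ (∀ v : EuclideanSpace ℝ (Fin 3) → EuclideanSpace ℝ (Fin 3), (ContDiff ℝ (⊤ : ℕ∞) v ∧
      Literature.Analysis.FluidPDE.VectorCalculus.IsDivFree v ∧ (∫⁻ x, ‖iteratedFDeriv ℝ 0 v x‖ₑ ^ 2 < ⊤) ∧ (∫⁻ x,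
      ‖iteratedFDeriv ℝ 1 v x‖ₑ ^ 2 < ⊤) ∧ (∫⁻ x, ‖iteratedFDeriv ℝ 2 v x‖ₑ ^ 2 < ⊤)) → (∫ x,
      ⟪Literature.Analysis.FluidPDE.curl v x, fderiv ℝ v x (Literature.Analysis.FluidPDE.curl v x)⟫_ℝ) ≤ c * (∫ x,
      ‖Literature.Analysis.FluidPDE.curl v x‖ ^ 2) ^ (3 / 4 : ℝ) * (∫ x,
      Literature.Analysis.FluidPDE.frobeniusNormSq (fderiv ℝ (Literature.Analysis.FluidPDE.curl v) x)) ^ (3 / 4 :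
      ℝ)) ∧ ∀ c' : ℝ, (∀ w : EuclideanSpace ℝ (Fin 3) → EuclideanSpace ℝ (Fin 3), (ContDiff ℝ (⊤ : ℕ∞) w ∧
      Literature.Analysis.FluidPDE.VectorCalculus.IsDivFree w ∧ (∫⁻ x, ‖iteratedFDeriv ℝ 0 w x‖ₑ ^ 2 < ⊤) ∧ (∫⁻ x,
      ‖iteratedFDeriv ℝ 1 w x‖ₑ ^ 2 < ⊤) ∧ (∫⁻ x, ‖iteratedFDeriv ℝ 2 w x‖ₑ ^ 2 < ⊤)) → (∫ x,
      ⟪Literature.Analysis.FluidPDE.curl w x, fderiv ℝ w x (Literature.Analysis.FluidPDE.curl w x)⟫_ℝ) ≤ c' * (∫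
      x, ‖Literature.Analysis.FluidPDE.curl w x‖ ^ 2) ^ (3 / 4 : ℝ) * (∫ x,
      Literature.Analysis.FluidPDE.frobeniusNormSq (fderiv ℝ (Literature.Analysis.FluidPDE.curl w) x)) ^ (3 / 4 :
      ℝ)) → c ≤ c') → ∀ ν : ℝ, 0 < ν → ∃ m : EuclideanSpace ℝ (Fin 3) → EuclideanSpace ℝ (Fin 3), ((ContDiff ℝ (⊤
      : ℕ∞) m ∧ Literature.Analysis.FluidPDE.VectorCalculus.IsDivFree m ∧ (∫⁻ x, ‖iteratedFDeriv ℝ 0 m x‖ₑ ^ 2 <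
      ⊤) ∧ (∫⁻ x, ‖iteratedFDeriv ℝ 1 m x‖ₑ ^ 2 < ⊤) ∧ (∫⁻ x, ‖iteratedFDeriv ℝ 2 m x‖ₑ ^ 2 < ⊤)) ∧ 0 < (∫ x,
      ‖Literature.Analysis.FluidPDE.curl m x‖ ^ 2) ∧ (∫ x, ⟪Literature.Analysis.FluidPDE.curl m x, fderiv ℝ m x
      (Literature.Analysis.FluidPDE.curl m x)⟫_ℝ) = c * (∫ x, ‖Literature.Analysis.FluidPDE.curl m x‖ ^ 2) ^ (3 /
      4 : ℝ) * (∫ x, Literature.Analysis.FluidPDE.frobeniusNormSq (fderiv ℝ (Literature.Analysis.FluidPDE.curl m)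
      x)) ^ (3 / 4 : ℝ) ∧ (∫ x, Literature.Analysis.FluidPDE.frobeniusNormSq (fderiv ℝ
      (Literature.Analysis.FluidPDE.curl m) x)) = 81 * c ^ 4 / (256 * ν ^ 4) * (∫ x,
      ‖Literature.Analysis.FluidPDE.curl m x‖ ^ 2) ^ 3) := by
  intro c hsharp ν' hν'
  obtain ⟨ν, hν, m, hm⟩ := attained_of_nearSaturationNearMaximiser hN c hsharp
  exact ⟨fun y => (ν' / ν) • m y, normalisedMaximiser_const_smul hν hν' hm⟩

/-- **The attainment dichotomy for the sharp constant, viscosity-free**: normalised maximisers exist at every `ν > 0` or at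
no `ν > 0`. [folklore] -/
theorem attainment_dichotomy :
    ∀ c : ℝ, (0 < c ∧ (∀ v : EuclideanSpace ℝ (Fin 3) → EuclideanSpace ℝ (Fin 3), (ContDiff ℝ (⊤ : ℕ∞) v ∧
      Literature.Analysis.FluidPDE.VectorCalculus.IsDivFree v ∧ (∫⁻ x, ‖iteratedFDeriv ℝ 0 v x‖ₑ ^ 2 < ⊤) ∧ (∫⁻ x,
      ‖iteratedFDeriv ℝ 1 v x‖ₑ ^ 2 < ⊤) ∧ (∫⁻ x, ‖iteratedFDeriv ℝ 2 v x‖ₑ ^ 2 < ⊤)) → (∫ x,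
      ⟪Literature.Analysis.FluidPDE.curl v x, fderiv ℝ v x (Literature.Analysis.FluidPDE.curl v x)⟫_ℝ) ≤ c * (∫ x,
      ‖Literature.Analysis.FluidPDE.curl v x‖ ^ 2) ^ (3 / 4 : ℝ) * (∫ x,
      Literature.Analysis.FluidPDE.frobeniusNormSq (fderiv ℝ (Literature.Analysis.FluidPDE.curl v) x)) ^ (3 / 4 :
      ℝ)) ∧ ∀ c' : ℝ, (∀ w : EuclideanSpace ℝ (Fin 3) → EuclideanSpace ℝ (Fin 3), (ContDiff ℝ (⊤ : ℕ∞) w ∧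
      Literature.Analysis.FluidPDE.VectorCalculus.IsDivFree w ∧ (∫⁻ x, ‖iteratedFDeriv ℝ 0 w x‖ₑ ^ 2 < ⊤) ∧ (∫⁻ x,
      ‖iteratedFDeriv ℝ 1 w x‖ₑ ^ 2 < ⊤) ∧ (∫⁻ x, ‖iteratedFDeriv ℝ 2 w x‖ₑ ^ 2 < ⊤)) → (∫ x,
      ⟪Literature.Analysis.FluidPDE.curl w x, fderiv ℝ w x (Literature.Analysis.FluidPDE.curl w x)⟫_ℝ) ≤ c' * (∫
      x, ‖Literature.Analysis.FluidPDE.curl w x‖ ^ 2) ^ (3 / 4 : ℝ) * (∫ x,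
      Literature.Analysis.FluidPDE.frobeniusNormSq (fderiv ℝ (Literature.Analysis.FluidPDE.curl w) x)) ^ (3 / 4 :
      ℝ)) → c ≤ c') → (∀ ν : ℝ, 0 < ν → ∃ m : EuclideanSpace ℝ (Fin 3) → EuclideanSpace ℝ (Fin 3), ((ContDiff ℝ (⊤
      : ℕ∞) m ∧ Literature.Analysis.FluidPDE.VectorCalculus.IsDivFree m ∧ (∫⁻ x, ‖iteratedFDeriv ℝ 0 m x‖ₑ ^ 2 <
      ⊤) ∧ (∫⁻ x, ‖iteratedFDeriv ℝ 1 m x‖ₑ ^ 2 < ⊤) ∧ (∫⁻ x, ‖iteratedFDeriv ℝ 2 m x‖ₑ ^ 2 < ⊤)) ∧ 0 < (∫ x,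
      ‖Literature.Analysis.FluidPDE.curl m x‖ ^ 2) ∧ (∫ x, ⟪Literature.Analysis.FluidPDE.curl m x, fderiv ℝ m x
      (Literature.Analysis.FluidPDE.curl m x)⟫_ℝ) = c * (∫ x, ‖Literature.Analysis.FluidPDE.curl m x‖ ^ 2) ^ (3 /
      4 : ℝ) * (∫ x, Literature.Analysis.FluidPDE.frobeniusNormSq (fderiv ℝ (Literature.Analysis.FluidPDE.curl m)
      x)) ^ (3 / 4 : ℝ) ∧ (∫ x, Literature.Analysis.FluidPDE.frobeniusNormSq (fderiv ℝ
      (Literature.Analysis.FluidPDE.curl m) x)) = 81 * c ^ 4 / (256 * ν ^ 4) * (∫ x,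
      ‖Literature.Analysis.FluidPDE.curl m x‖ ^ 2) ^ 3)) ∨ (∀ ν : ℝ, 0 < ν → ∀ m : EuclideanSpace ℝ (Fin 3) →
      EuclideanSpace ℝ (Fin 3), ¬ ((ContDiff ℝ (⊤ : ℕ∞) m ∧ Literature.Analysis.FluidPDE.VectorCalculus.IsDivFree
      m ∧ (∫⁻ x, ‖iteratedFDeriv ℝ 0 m x‖ₑ ^ 2 < ⊤) ∧ (∫⁻ x, ‖iteratedFDeriv ℝ 1 m x‖ₑ ^ 2 < ⊤) ∧ (∫⁻ x,
      ‖iteratedFDeriv ℝ 2 m x‖ₑ ^ 2 < ⊤)) ∧ 0 < (∫ x, ‖Literature.Analysis.FluidPDE.curl m x‖ ^ 2) ∧ (∫ x,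
      ⟪Literature.Analysis.FluidPDE.curl m x, fderiv ℝ m x (Literature.Analysis.FluidPDE.curl m x)⟫_ℝ) = c * (∫ x,
      ‖Literature.Analysis.FluidPDE.curl m x‖ ^ 2) ^ (3 / 4 : ℝ) * (∫ x,
      Literature.Analysis.FluidPDE.frobeniusNormSq (fderiv ℝ (Literature.Analysis.FluidPDE.curl m) x)) ^ (3 / 4 :
      ℝ) ∧ (∫ x, Literature.Analysis.FluidPDE.frobeniusNormSq (fderiv ℝ (Literature.Analysis.FluidPDE.curl m) x))
      = 81 * c ^ 4 / (256 * ν ^ 4) * (∫ x, ‖Literature.Analysis.FluidPDE.curl m x‖ ^ 2) ^ 3)) := by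
  intro c _hsharp
  by_cases h : ∃ ν : ℝ, 0 < ν ∧ ∃ m : EuclideanSpace ℝ (Fin 3) → EuclideanSpace ℝ (Fin 3), ((ContDiff ℝ (⊤ : ℕ∞) m ∧ Literature.Analysis.FluidPDE.VectorCalculus.IsDivFree m ∧ (∫⁻ x, ‖iteratedFDeriv
        ℝ 0 m x‖ₑ ^ 2 < ⊤) ∧ (∫⁻ x, ‖iteratedFDeriv ℝ 1 m x‖ₑ ^ 2 < ⊤) ∧ (∫⁻ x, ‖iteratedFDeriv ℝ 2 m x‖ₑ ^ 2 <
        ⊤)) ∧ 0 < (∫ x, ‖Literature.Analysis.FluidPDE.curl m x‖ ^ 2) ∧ (∫ x, ⟪Literature.Analysis.FluidPDE.curl m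
        x, fderiv ℝ m x (Literature.Analysis.FluidPDE.curl m x)⟫_ℝ) = c * (∫ x, ‖Literature.Analysis.FluidPDE.curl
        m x‖ ^ 2) ^ (3 / 4 : ℝ) * (∫ x, Literature.Analysis.FluidPDE.frobeniusNormSq (fderiv ℝ
        (Literature.Analysis.FluidPDE.curl m) x)) ^ (3 / 4 : ℝ) ∧ (∫ x,
        Literature.Analysis.FluidPDE.frobeniusNormSq (fderiv ℝ (Literature.Analysis.FluidPDE.curl m) x)) = 81 * c
        ^ 4 / (256 * ν ^ 4) * (∫ x, ‖Literature.Analysis.FluidPDE.curl m x‖ ^ 2) ^ 3)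
  · obtain ⟨ν, hν, m, hm⟩ := h
    exact Or.inl fun ν' hν' => ⟨fun y => (ν' / ν) • m y, normalisedMaximiser_const_smul hν hν' hm⟩
  · exact Or.inr fun ν hν m hm => h ⟨ν, hν, m, hm⟩

end Attainment

end LerayFloorGap

end Summit.NavierStokesRegularity.NavierStokesRegularity.Theorems

end
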